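import Literature.NumberTheory.Sieve.PolymathGEHWindowPieces
import Literature.NumberTheory.Sieve.PolymathGEHDivisorShort
import HarnessLib

/-!
# Proposition 2.7 (`GEH ⟹ EH`): the `ℓ¹` mass of the straddling pieces

Trunk AntSieve, tooling toward the named fact `Literature.NumberTheory.Sieve.weakDHL_three_two_of_GEH`
(D. H. J. Polymath, Res. Math. Sci. 1:12 (2014) = arXiv:1407.4897, Theorem 3.2(xii)).  The pairs of
pieces `(α_s, β_t)` whose product range straddles an end `Y ∈ {N₀, N₁}` of the window contribute,
besides a `GEH` term, the `ℓ¹` mass `Σ ‖α_s‖₁ ‖β_t‖₁` (file `PolymathGEHWindowPieces`).  Since the blocks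
`(⌊ρ^s⌋, ⌊ρ^{s+1}⌋] × (m_t, ⌊ρ^{t+1}⌋]` are pairwise disjoint and, for a straddling pair, consist of
`(m, c)` with `mc ∈ (Y/ρ², ρ² Y)`, that mass is at most `Σ_{n ∈ (Y/ρ², ρ²Y)} (|a| ⋆ Λ)(n) ≤ Σ τ(n) log n`
over two short ranges (`sum_straddle_l1_le`), which the short-interval divisor bound
(`sum_Ioc_sigma_zero_le`) makes `O((ρ − 1) X log² X + √X log X)`.

## References

* [Polymath8b2014] D. H. J. Polymath, Res. Math. Sci. 1 (2014), Art. 12 = arXiv:1407.4897,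
  Proposition 2.7 (p. 7).
-/

noncomputable section

open Finset Real
open scoped ArithmeticFunction.Moebius ArithmeticFunction.vonMangoldt ArithmeticFunction.sigma

namespace Literature.NumberTheory.Sieve

open BFI (absAF absAF_apply)

namespace GEHtoEH

/-! ### Disjoint blocks -/

/-- The `α`-blocks `(⌊ρ^s⌋, ⌊ρ^{s+1}⌋]` are pairwise disjoint (`ρ ≥ 1`). [folklore] -/
theorem disjoint_Ioc_lo {ρ : ℝ} (hρ : 1 ≤ ρ) {s s' : ℕ} (h : s ≠ s') :
    Disjoint (Ioc (lo ρ s) (lo ρ (s + 1))) (Ioc (lo ρ s') (lo ρ (s' + 1))) := by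
  wlog hlt : s < s' generalizing s s'
  · exact (this h.symm (lt_of_le_of_ne (not_lt.1 hlt) h.symm)).symm
  rw [Finset.disjoint_left]
  intro m hm hm'
  rw [Finset.mem_Ioc] at hm hm'
  have := lo_mono hρ (show s + 1 ≤ s' by omega)
  omega

/-- The `β`-blocks `(m_t, ⌊ρ^{t+1}⌋]` are pairwise disjoint (`ρ ≥ 1`). [folklore] -/
theorem disjoint_Ioc_mV (V : ℕ) {ρ : ℝ} (hρ : 1 ≤ ρ) {t t' : ℕ} (h : t ≠ t') :
    Disjoint (Ioc (mV V ρ t) (lo ρ (t + 1))) (Ioc (mV V ρ t') (lo ρ (t' + 1))) := by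
  refine Disjoint.mono ?_ ?_ (disjoint_Ioc_lo hρ h) <;>
  · intro c hc
    rw [Finset.mem_Ioc] at hc ⊢
    exact ⟨lt_of_le_of_lt (le_max_right _ _) hc.1, hc.2⟩

/-- The product blocks of distinct pairs are disjoint. [folklore] -/
theorem pairwiseDisjoint_blocks (V : ℕ) {ρ : ℝ} (hρ : 1 ≤ ρ) (P : Finset (ℕ × ℕ)) :
    (P : Set (ℕ × ℕ)).PairwiseDisjoint
      (fun st => Ioc (lo ρ st.1) (lo ρ (st.1 + 1)) ×ˢ Ioc (mV V ρ st.2) (lo ρ (st.2 + 1))) := by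
  intro st _ st' _ hne
  rw [Function.onFun, Finset.disjoint_product]
  by_cases h1 : st.1 = st'.1
  · right
    refine disjoint_Ioc_mV V hρ fun h2 => hne ?_
    exact Prod.ext h1 h2
  · left
    exact disjoint_Ioc_lo hρ h1

/-! ### From blocks to a sum over `n` -/

/-- **Block sums to a convolution sum**: if every `(m, c)` in the blocks of the pairs in `P` has
`mc ∈ R`, then for nonnegative `F, G`,
`Σ_{(s,t) ∈ P} (Σ_{m ∈ block_s} F m)(Σ_{c ∈ block_t} G c) ≤ Σ_{n ∈ R} (F ⋆ G)(n)`. [folklore] -/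
theorem sum_blocks_le_sum_mul (V : ℕ) {ρ : ℝ} (hρ : 1 ≤ ρ) (P : Finset (ℕ × ℕ)) (R : Finset ℕ)
    (F G : ArithmeticFunction ℝ) (hF : ∀ n, 0 ≤ F n) (hG : ∀ n, 0 ≤ G n)
    (hR : ∀ st ∈ P, ∀ m ∈ Ioc (lo ρ st.1) (lo ρ (st.1 + 1)), ∀ c ∈ Ioc (mV V ρ st.2) (lo ρ (st.2 + 1)),
      m * c ∈ R) (hR0 : 0 ∉ R) :
    ∑ st ∈ P, (∑ m ∈ Ioc (lo ρ st.1) (lo ρ (st.1 + 1)), F m) * ∑ c ∈ Ioc (mV V ρ st.2) (lo ρ (st.2 + 1)), G c ≤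
      ∑ n ∈ R, (F * G) n := by
  -- blocks as a disjoint union of pairs
  have h1 : ∑ st ∈ P, (∑ m ∈ Ioc (lo ρ st.1) (lo ρ (st.1 + 1)), F m) * ∑ c ∈ Ioc (mV V ρ st.2) (lo ρ (st.2 + 1)), G c =
      ∑ p ∈ P.biUnion (fun st => Ioc (lo ρ st.1) (lo ρ (st.1 + 1)) ×ˢ Ioc (mV V ρ st.2) (lo ρ (st.2 + 1))),
        F p.1 * G p.2 := by
    rw [Finset.sum_biUnion (pairwiseDisjoint_blocks V hρ P)]
    refine Finset.sum_congr rfl fun st _ => ?_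
    rw [Finset.sum_product, Finset.sum_mul_sum]
  -- the pairs inject into the antidiagonals of `R`
  have h2 : P.biUnion (fun st => Ioc (lo ρ st.1) (lo ρ (st.1 + 1)) ×ˢ Ioc (mV V ρ st.2) (lo ρ (st.2 + 1))) ⊆
      R.biUnion fun n => n.divisorsAntidiagonal := by
    intro p hp
    rw [Finset.mem_biUnion] at hp ⊢
    obtain ⟨st, hst, hp⟩ := hp
    rw [Finset.mem_product] at hp
    refine ⟨p.1 * p.2, hR st hst p.1 hp.1 p.2 hp.2, ?_⟩
    rw [Nat.mem_divisorsAntidiagonal]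
    refine ⟨rfl, fun h => hR0 ?_⟩
    rw [← h]; exact hR st hst p.1 hp.1 p.2 hp.2
  have h3 : (R : Set ℕ).PairwiseDisjoint fun n => n.divisorsAntidiagonal := by
    intro n _ n' _ hne
    rw [Function.onFun, Finset.disjoint_left]
    intro p hp hp'
    rw [Nat.mem_divisorsAntidiagonal] at hp hp'
    exact hne (hp.1.symm.trans hp'.1)
  rw [h1]
  calc ∑ p ∈ P.biUnion (fun st => Ioc (lo ρ st.1) (lo ρ (st.1 + 1)) ×ˢ Ioc (mV V ρ st.2) (lo ρ (st.2 + 1))),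
        F p.1 * G p.2
      ≤ ∑ p ∈ R.biUnion (fun n => n.divisorsAntidiagonal), F p.1 * G p.2 :=
        Finset.sum_le_sum_of_subset_of_nonneg h2 fun p _ _ => mul_nonneg (hF _) (hG _)
    _ = ∑ n ∈ R, (F * G) n := by
        rw [Finset.sum_biUnion h3]
        refine Finset.sum_congr rfl fun n _ => ?_
        rw [ArithmeticFunction.mul_apply]

/-! ### `(|a| ⋆ Λ)(n) ≤ τ(n) log n` -/

/-- `(|a| ⋆ Λ)(n) ≤ τ(n) log n`. [folklore] -/
theorem absA_mul_vonMangoldt_le (U n : ℕ) :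
    (absAF (aFun U) * (Λ : ArithmeticFunction ℝ)) n ≤ (σ 0 n : ℝ) * Real.log n := by
  rcases Nat.eq_zero_or_pos n with rfl | hn
  · simp
  rw [ArithmeticFunction.mul_apply]
  calc ∑ p ∈ n.divisorsAntidiagonal, absAF (aFun U) p.1 * (Λ : ArithmeticFunction ℝ) p.2
      ≤ ∑ p ∈ n.divisorsAntidiagonal, (σ 0 n : ℝ) * (Λ : ArithmeticFunction ℝ) p.2 := by
        refine Finset.sum_le_sum fun p hp => ?_
        rw [Nat.mem_divisorsAntidiagonal] at hp
        refine mul_le_mul_of_nonneg_right ?_ ArithmeticFunction.vonMangoldt_nonneg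
        rw [absAF_apply]
        refine (abs_aFun_le U p.1).trans ?_
        have h1 : σ 0 p.1 ≤ σ 0 n := by
          rw [ArithmeticFunction.sigma_zero_apply, ArithmeticFunction.sigma_zero_apply]
          exact Finset.card_le_card (Nat.divisors_subset_of_dvd hp.2 (Dvd.intro _ hp.1))
        exact_mod_cast h1
    _ = (σ 0 n : ℝ) * ∑ p ∈ n.divisorsAntidiagonal, (Λ : ArithmeticFunction ℝ) p.2 := by rw [Finset.mul_sum]
    _ = (σ 0 n : ℝ) * Real.log n := by
        congr 1
        rw [Nat.sum_divisorsAntidiagonal' (fun _ c => ((Λ : ArithmeticFunction ℝ) c : ℝ)),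
          ← ArithmeticFunction.vonMangoldt_sum]

/-! ### Straddling blocks live in a short range -/

/-- The product range of a pair has ratio at most `ρ²`:
`⌊ρ^{s+1}⌋ ⌊ρ^{t+1}⌋ < ρ² (⌊ρ^s⌋ + 1)(m_t + 1)`. [folklore] -/
theorem hi_lt_rho_sq_mul_lo {ρ : ℝ} (hρ : 1 ≤ ρ) (V s t : ℕ) :
    ((lo ρ (s + 1) * lo ρ (t + 1) : ℕ) : ℝ) < ρ ^ 2 * ((lo ρ s + 1 : ℕ) * (mV V ρ t + 1 : ℕ)) := by
  have hρ0 : 0 < ρ := by linarith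
  have h1 : (lo ρ (s + 1) : ℝ) < ρ * (lo ρ s + 1 : ℕ) := by
    rw [lo, lo]
    calc (⌊ρ ^ (s + 1)⌋₊ : ℝ) ≤ ρ ^ (s + 1) := Nat.floor_le (by positivity)
      _ = ρ * ρ ^ s := by ring
      _ < ρ * (⌊ρ ^ s⌋₊ + 1 : ℕ) := by
          push_cast
          exact mul_lt_mul_of_pos_left (Nat.lt_floor_add_one _) hρ0
  have h2 : (lo ρ (t + 1) : ℝ) < ρ * (mV V ρ t + 1 : ℕ) := by
    rw [lo, mV, lo]
    calc (⌊ρ ^ (t + 1)⌋₊ : ℝ) ≤ ρ ^ (t + 1) := Nat.floor_le (by positivity)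
      _ = ρ * ρ ^ t := by ring
      _ < ρ * (⌊ρ ^ t⌋₊ + 1 : ℕ) := by
          push_cast
          exact mul_lt_mul_of_pos_left (Nat.lt_floor_add_one _) hρ0
      _ ≤ ρ * (max V ⌊ρ ^ t⌋₊ + 1 : ℕ) := by
          refine mul_le_mul_of_nonneg_left ?_ hρ0.le
          exact_mod_cast Nat.succ_le_succ (le_max_right _ _)
  have h0s : (0 : ℝ) ≤ lo ρ (s + 1) := Nat.cast_nonneg _
  have h0t : (0 : ℝ) ≤ lo ρ (t + 1) := Nat.cast_nonneg _
  push_cast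
  calc (lo ρ (s + 1) : ℝ) * lo ρ (t + 1) ≤ (ρ * (lo ρ s + 1 : ℕ)) * lo ρ (t + 1) :=
        mul_le_mul_of_nonneg_right h1.le h0t
    _ < (ρ * (lo ρ s + 1 : ℕ)) * (ρ * (mV V ρ t + 1 : ℕ)) := by
        refine mul_lt_mul_of_pos_left h2 ?_
        have : (0 : ℝ) < (lo ρ s + 1 : ℕ) := by positivity
        positivity
    _ = _ := by push_cast; ring

/-- **Straddling blocks are short**: if the product range of the pair `(s, t)` straddles `Y`
(`(⌊ρ^s⌋+1)(m_t+1) ≤ Y < ⌊ρ^{s+1}⌋⌊ρ^{t+1}⌋`) then every `(m, c)` in its block has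
`mc ∈ (⌊Y/ρ²⌋, ⌊ρ² Y⌋]`. [folklore] -/
theorem mul_mem_Ioc_of_straddle {ρ : ℝ} (hρ : 1 ≤ ρ) {V s t Y : ℕ}
    (hlo : (lo ρ s + 1) * (mV V ρ t + 1) ≤ Y) (hhi : Y < lo ρ (s + 1) * lo ρ (t + 1))
    {m : ℕ} (hm : m ∈ Ioc (lo ρ s) (lo ρ (s + 1))) {c : ℕ} (hc : c ∈ Ioc (mV V ρ t) (lo ρ (t + 1))) :
    m * c ∈ Ioc ⌊(Y : ℝ) / ρ ^ 2⌋₊ ⌊ρ ^ 2 * Y⌋₊ := by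
  rw [Finset.mem_Ioc] at hm hc ⊢
  have hρ2 : (1 : ℝ) ≤ ρ ^ 2 := one_le_pow₀ hρ
  have hρ20 : (0 : ℝ) < ρ ^ 2 := by positivity
  have hratio := hi_lt_rho_sq_mul_lo hρ V s t
  have hmc_lo : (lo ρ s + 1) * (mV V ρ t + 1) ≤ m * c := Nat.mul_le_mul (by omega) (by omega)
  have hmc_hi : m * c ≤ lo ρ (s + 1) * lo ρ (t + 1) := Nat.mul_le_mul hm.2 hc.2
  constructor
  · -- `Y < hi < ρ² lo' ≤ ρ² mc`, so `Y/ρ² < mc`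
    rw [Nat.floor_lt (by positivity), div_lt_iff₀ hρ20]
    have h1 : (Y : ℝ) < (lo ρ (s + 1) * lo ρ (t + 1) : ℕ) := by exact_mod_cast hhi
    have h2 : ((lo ρ s + 1 : ℕ) * (mV V ρ t + 1 : ℕ) : ℝ) ≤ (m * c : ℕ) := by exact_mod_cast hmc_lo
    calc (Y : ℝ) < ρ ^ 2 * ((lo ρ s + 1 : ℕ) * (mV V ρ t + 1 : ℕ)) := h1.trans hratio
      _ ≤ ρ ^ 2 * (m * c : ℕ) := mul_le_mul_of_nonneg_left h2 hρ20.le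
      _ = (m * c : ℕ) * ρ ^ 2 := mul_comm _ _
  · -- `mc ≤ hi < ρ² lo' ≤ ρ² Y`
    refine Nat.le_floor ?_
    have h1 : ((m * c : ℕ) : ℝ) ≤ (lo ρ (s + 1) * lo ρ (t + 1) : ℕ) := by exact_mod_cast hmc_hi
    have h2 : ((lo ρ s + 1 : ℕ) * (mV V ρ t + 1 : ℕ) : ℝ) ≤ Y := by exact_mod_cast hlo
    calc ((m * c : ℕ) : ℝ) ≤ (lo ρ (s + 1) * lo ρ (t + 1) : ℕ) := h1
      _ ≤ ρ ^ 2 * ((lo ρ s + 1 : ℕ) * (mV V ρ t + 1 : ℕ)) := hratio.le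
      _ ≤ ρ ^ 2 * Y := mul_le_mul_of_nonneg_left h2 hρ20.le

/-! ### The `ℓ¹` mass of the straddling pairs -/

/-- The straddling pairs for the window ends `N₀, N₁` among `s, t ≤ S`. [folklore] -/
def straddleSet (V : ℕ) (ρ : ℝ) (S N₀ N₁ : ℕ) : Finset (ℕ × ℕ) :=
  (range (S + 1) ×ˢ range (S + 1)).filter fun st =>
    ((lo ρ st.1 + 1) * (mV V ρ st.2 + 1) ≤ N₀ ∧ N₀ < lo ρ (st.1 + 1) * lo ρ (st.2 + 1)) ∨
    ((lo ρ st.1 + 1) * (mV V ρ st.2 + 1) ≤ N₁ ∧ N₁ < lo ρ (st.1 + 1) * lo ρ (st.2 + 1))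

/-- The two short ranges `(⌊Y/ρ²⌋, ⌊ρ²Y⌋]`, `Y ∈ {N₀, N₁}`. [folklore] -/
def straddleRange (ρ : ℝ) (N₀ N₁ : ℕ) : Finset ℕ :=
  Ioc ⌊(N₀ : ℝ) / ρ ^ 2⌋₊ ⌊ρ ^ 2 * N₀⌋₊ ∪ Ioc ⌊(N₁ : ℝ) / ρ ^ 2⌋₊ ⌊ρ ^ 2 * N₁⌋₊

/-- **`ℓ¹` mass of the straddling pairs**:
`Σ_{(s,t) straddling} ‖α_s‖₁ ‖β_t‖₁ ≤ Σ_{n ∈ (⌊N₀/ρ²⌋, ⌊ρ²N₀⌋] ∪ (⌊N₁/ρ²⌋, ⌊ρ²N₁⌋]} τ(n) log n`.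
[cite: Polymath8b2014, Proposition 2.7] -/
theorem sum_straddle_l1_le (U V : ℕ) {ρ : ℝ} (hρ : 1 ≤ ρ) (S N₀ N₁ : ℕ) :
    ∑ st ∈ straddleSet V ρ S N₀ N₁,
      (∑ m ∈ Ioc (lo ρ st.1) (lo ρ (st.1 + 1)), |aFun U m|) *
        ∑ c ∈ Ioc (mV V ρ st.2) (lo ρ (st.2 + 1)), (Λ c : ℝ) ≤
      ∑ n ∈ straddleRange ρ N₀ N₁, (σ 0 n : ℝ) * Real.log n := by
  have h := sum_blocks_le_sum_mul V hρ (straddleSet V ρ S N₀ N₁) (straddleRange ρ N₀ N₁)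
    (absAF (aFun U)) (Λ : ArithmeticFunction ℝ) (fun n => abs_nonneg _)
    (fun n => ArithmeticFunction.vonMangoldt_nonneg) ?_ ?_
  · refine (le_of_eq_of_le ?_ h).trans (Finset.sum_le_sum fun n _ => absA_mul_vonMangoldt_le U n)
    refine Finset.sum_congr rfl fun st _ => ?_
    simp only [absAF_apply]
  · intro st hst m hm c hc
    rw [straddleSet, Finset.mem_filter] at hst
    rw [straddleRange, Finset.mem_union]
    rcases hst.2 with h0 | h1
    · exact Or.inl (mul_mem_Ioc_of_straddle hρ h0.1 h0.2 hm hc)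
    · exact Or.inr (mul_mem_Ioc_of_straddle hρ h1.1 h1.2 hm hc)
  · rw [straddleRange, Finset.mem_union, not_or, Finset.mem_Ioc, Finset.mem_Ioc]
    omega

end GEHtoEH

end Literature.NumberTheory.Sieve
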